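import Summits.AtomisticToContinuum.HydrodynamicLimit.Theorems.AntiMazurCoboundariesCorrectorPressureDecayKiferCanonicalLocalLimitTranslation
import Summits.AtomisticToContinuum.HydrodynamicLimit.Theorems.AntiMazurCoboundariesCorrectorPressureDecayKiferCanonicalLocalLimitBasics
import Literature.MathematicalPhysics.KineticTheory.CollisionTubePullbackPacking

/-!
# The canonical local limit, IV: hard core and density pass to the local limit (line `FirstLemma`, crux stmt-AtomisticToContinuum-14135)

Helper file of the registered stub `stub_georgiiCanonicalLocalLimit : Georgii1995_hardSphereCanonicalLocalLimit`
(Georgii 1995, equivalence of ensembles on the level of measures), namespace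
`Summit.AtomisticToContinuum.HydrodynamicLimit.Theorems.KiferCompactification`. Together with
`isTranslationInvariant_of_isCanonicalLocalLimit` (`…Translation.lean`) this file shows that ALL qualitative clauses of
the compactness half (E1) `CanonicalBlowUpLocallyCompact` of the decomposition (`…KiferCanonicalLocalLimit.lean`) are
automatic for setwise local limits, reducing (E1) to bare setwise sequential compactness
(`canonicalBlowUpLocallyCompact_of_exists_localLimit`):

* `count_unitCube_le_of_isHardCore`: a unit-hard-core configuration has at most `125` points with position in
  `[0,1)³` (packing, `card_le_of_separated`);
* `ae_isHardCore_of_isCanonicalLocalLimit`: a probability local limit is carried by unit-hard-core configurations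
  (the hard core of the window `Λ_m` is a local event of full measure at every finite `N`, and the hard core is the
  intersection of these events over `m`);
* `density_of_isCanonicalLocalLimit`: a probability local limit has density EXACTLY `σ³` (on hard-core configurations
  the density integrand is a finite combination of the local events `{N([0,1)³ × ℝ³) = j}`, `j ≤ 125`, and each
  finite-`N` density is `σ³`, `density_canonicalBlowUp`);
* `canonicalBlowUpLocallyCompact_of_exists_localLimit`: (E1) follows from the existence, along a subsequence of any
  `N k → ∞`, of SOME probability law which is a setwise local limit.

References: H.-O. Georgii, J. Stat. Phys. 80 (1995) §3; O. Kallenberg, Foundations of Modern Probability, Ch. 16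
(context: local convergence of point processes).
-/

noncomputable section

open MeasureTheory Set Filter Topology Function Metric
open scoped ENNReal NNReal

namespace Summit.AtomisticToContinuum.HydrodynamicLimit.Theorems.KiferCompactification

open Literature.MathematicalPhysics.KineticTheory (T3 V3 hsDiameter hsDiameter_pos localGibbsLaw blowUpPoint blowUp
  card_le_of_separated)
open Literature.MathematicalPhysics.KineticTheory.PointProcess (windowLaw windowRestrict centredBox density
  measurable_windowRestrict)
open Literature.Analysis.FluidPDE (HardSphereFlow Config IsHardCore IsTranslationInvariant)
open Literature.Analysis.FunctionSpaces (PointConfig)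
open Literature.Analysis.FunctionSpaces.Torus (unitCube measurableSet_unitCube mem_unitCube)

/-! ## Hard core: windows and packing -/

/-- Windows of hard-core configurations are hard-core configurations. -/
theorem isHardCore_windowRestrict {δ : ℝ} {ω : PointConfig (V3 × V3)} (h : IsHardCore δ ω) (Λ : Set V3) :
    IsHardCore δ (windowRestrict Λ ω) :=
  fun p hp q hq hpq => h p hp.1 q hq.1 hpq

/-- A configuration all of whose windows on the centred cubes are `δ`-hard-core is `δ`-hard-core. -/
theorem isHardCore_of_forall_windowRestrict {δ : ℝ} {ω : PointConfig (V3 × V3)}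
    (h : ∀ m : ℕ, IsHardCore δ (windowRestrict (centredBox m) ω)) : IsHardCore δ ω := by
  intro p hp q hq hpq
  obtain ⟨m₁, hm₁⟩ := exists_mem_centredBox p.1
  obtain ⟨m₂, hm₂⟩ := exists_mem_centredBox q.1
  exact h (max m₁ m₂) p ⟨hp, centredBox_mono (le_max_left m₁ m₂) hm₁⟩ q
    ⟨hq, centredBox_mono (le_max_right m₁ m₂) hm₂⟩ hpq

/-- The unit cube `[0,1)³` lies in the centred cube `Λ_0 = [-1,1)³`. -/
theorem unitCube_subset_centredBox_zero : unitCube (Fin 3) ⊆ centredBox (d := Fin 3) 0 := by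
  intro y hy i
  have h := (mem_unitCube.1 hy) i
  simp only [Nat.cast_zero, zero_add]
  constructor <;> linarith [h.1, h.2]

/-- **Packing in the unit cube**: a unit-hard-core configuration has at most `125` points with position in `[0,1)³`
(positions of norm `≤ 2`, pairwise `≥ 1` apart: at most `(2·2 + 1)³`). -/
theorem count_unitCube_le_of_isHardCore {ω : PointConfig (V3 × V3)} (h : IsHardCore 1 ω) :
    ω.count (Prod.fst ⁻¹' unitCube (Fin 3)) ≤ ((125 : ℕ) : ℕ∞) := by
  by_contra hlt
  push Not at hlt
  have h126 : ((126 : ℕ) : ℕ∞) ≤ ω.count (Prod.fst ⁻¹' unitCube (Fin 3)) := by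
    have : ((126 : ℕ) : ℕ∞) = ((125 : ℕ) : ℕ∞) + 1 := by norm_num
    rw [this]
    exact Order.add_one_le_of_lt hlt
  obtain ⟨t, hts, ht⟩ := Set.exists_subset_encard_eq h126
  have htfin : t.Finite := Set.finite_of_encard_eq_coe ht
  have hcard : htfin.toFinset.card = 126 := by
    have h1 := htfin.encard_eq_coe_toFinset_card
    rw [ht] at h1
    exact_mod_cast h1.symm
  have hR : ∀ p ∈ htfin.toFinset, ‖p.1‖ ≤ 2 := fun p hp => by
    have hcube : p.1 ∈ unitCube (Fin 3) := (hts (htfin.mem_toFinset.1 hp)).2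
    have h2 := norm_le_of_mem_centredBox (unitCube_subset_centredBox_zero hcube)
    norm_num at h2
    exact h2
  have hsep : ∀ p ∈ htfin.toFinset, ∀ p' ∈ htfin.toFinset, p ≠ p' → (1 : ℝ) ≤ ‖p.1 - p'.1‖ :=
    fun p hp p' hp' hne => h p (hts (htfin.mem_toFinset.1 hp)).1 p' (hts (htfin.mem_toFinset.1 hp')).1 hne
  have hpack := card_le_of_separated htfin.toFinset Prod.fst one_pos (by norm_num : (0 : ℝ) ≤ 2) hR hsep
  rw [hcard] at hpack
  norm_num at hpack

/-! ## Hard core of local limits -/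

/-- **A probability local limit of the x-averaged blown-up canonical laws is carried by unit-hard-core
configurations** (`0 < σ ≤ 1/2`, `a, θ > 0`; no growth of the sizes is needed). -/
theorem ae_isHardCore_of_isCanonicalLocalLimit {σ a θ : ℝ} {u₀ : V3} (hσ : 0 < σ) (hσ2 : σ ≤ 1 / 2) (ha : 0 < a)
    (hθ : 0 < θ) {N : ℕ → ℕ}
    {Φ : ∀ k, HardSphereFlow (Literature.Analysis.FluidPDE.Torus.geometry (Fin 3)) (hsDiameter σ (N k)) (N k + 1)}
    {G : Measure (PointConfig (V3 × V3))} [IsProbabilityMeasure G] (hG : IsCanonicalLocalLimit σ a θ u₀ N Φ G) :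
    ∀ᵐ ω ∂G, IsHardCore 1 ω := by
  set H : Set (PointConfig (V3 × V3)) := {ω | IsHardCore 1 ω} with hH
  have hHm : MeasurableSet H := measurableSet_setOf_isHardCore 1
  suffices hwin : ∀ m : ℕ, ∀ᵐ ω ∂G, windowRestrict (centredBox m) ω ∈ H by
    filter_upwards [ae_all_iff.2 hwin] with ω hω using isHardCore_of_forall_windowRestrict hω
  intro m
  have hΛm : MeasurableSet (centredBox (d := Fin 3) m) := measurableSet_centredBox_fin3 m
  have hpre : MeasurableSet (windowRestrict (M := V3) (centredBox (d := Fin 3) m) ⁻¹' H) :=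
    measurable_windowRestrict hΛm hHm
  -- at finite `N` the window hard core has full measure
  have hk : ∀ k, windowLaw (centredBox m) (canonicalBlowUpLaw σ a θ u₀ (N k) (Φ k)) H = 1 := by
    intro k
    haveI : IsProbabilityMeasure (canonicalBlowUpLaw σ a θ u₀ (N k) (Φ k)) :=
      isProbabilityMeasure_canonicalBlowUp u₀ hσ2 ha hθ (N k) (Φ k)
    have hae : ∀ᵐ ω ∂(canonicalBlowUpLaw σ a θ u₀ (N k) (Φ k)), ω ∈ windowRestrict (centredBox m) ⁻¹' H := by
      have h0 : ∀ᵐ ω ∂(canonicalBlowUpLaw σ a θ u₀ (N k) (Φ k)), IsHardCore 1 ω :=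
        ae_isHardCore_canonicalBlowUp hσ a θ u₀ (N k) (Φ k)
      filter_upwards [h0] with ω hω using isHardCore_windowRestrict hω _
    rw [Literature.MathematicalPhysics.KineticTheory.PointProcess.windowLaw,
      Measure.map_apply (measurable_windowRestrict hΛm) hHm]
    exact (prob_compl_eq_zero_iff hpre).1 (ae_iff.1 hae)
  have hlim : windowLaw (centredBox m) G H = 1 :=
    tendsto_nhds_unique (hG _ hΛm (isBounded_centredBox m) H hHm) (by simp_rw [hk]; exact tendsto_const_nhds)
  rw [Literature.MathematicalPhysics.KineticTheory.PointProcess.windowLaw,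
    Measure.map_apply (measurable_windowRestrict hΛm) hHm] at hlim
  exact ae_iff.2 ((prob_compl_eq_zero_iff hpre).2 hlim)

/-! ## Density of local limits -/

/-- Counting in the unit cube only sees the window `Λ_0 ⊇ [0,1)³`. -/
theorem count_windowRestrict_centredBox_zero (ω : PointConfig (V3 × V3)) :
    (windowRestrict (centredBox 0) ω).count (Prod.fst ⁻¹' unitCube (Fin 3)) =
      ω.count (Prod.fst ⁻¹' unitCube (Fin 3)) := by
  rw [Literature.MathematicalPhysics.KineticTheory.PointProcess.windowRestrict, PointConfig.count_restrict,
    Set.inter_eq_right.2 (preimage_mono unitCube_subset_centredBox_zero)]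

/-- The level events `{N([0,1)³ × ℝ³) = j}` are measurable. -/
theorem measurableSet_count_unitCube_eq (j : ℕ) :
    MeasurableSet {ω : PointConfig (V3 × V3) | ω.count (Prod.fst ⁻¹' unitCube (Fin 3)) = (j : ℕ∞)} :=
  (show MeasurableSet ({(j : ℕ∞)} : Set ℕ∞) from MeasurableSet.of_discrete).preimage
    (PointConfig.measurable_count (measurable_fst measurableSet_unitCube))

/-- **The density of a law carried by unit-hard-core configurations is a finite combination of level
probabilities**: `density μ = ∑_{j ≤ 125} j · μ{N([0,1)³ × ℝ³) = j}`. -/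
theorem density_eq_sum_of_ae_isHardCore (μ : Measure (PointConfig (V3 × V3))) (hμ : ∀ᵐ ω ∂μ, IsHardCore 1 ω) :
    density μ = ∑ j ∈ Finset.range 126,
      (j : ℝ≥0∞) * μ {ω : PointConfig (V3 × V3) | ω.count (Prod.fst ⁻¹' unitCube (Fin 3)) = (j : ℕ∞)} := by
  set S : Set (V3 × V3) := Prod.fst ⁻¹' unitCube (Fin 3) with hS
  have hA : ∀ j : ℕ, MeasurableSet {ω : PointConfig (V3 × V3) | ω.count S = (j : ℕ∞)} := measurableSet_count_unitCube_eq
  -- pointwise identity on hard-core configurations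
  have hpt : ∀ ω : PointConfig (V3 × V3), IsHardCore 1 ω →
      ((ω.count S : ℕ∞) : ℝ≥0∞) =
        ∑ j ∈ Finset.range 126, (j : ℝ≥0∞) * {ω : PointConfig (V3 × V3) | ω.count S = (j : ℕ∞)}.indicator 1 ω := by
    intro ω hω
    have hle : ω.count S ≤ ((125 : ℕ) : ℕ∞) := count_unitCube_le_of_isHardCore hω
    obtain ⟨j₀, hj₀⟩ := ENat.ne_top_iff_exists.1 (ne_top_of_le_ne_top (ENat.coe_ne_top 125) hle)
    have hj₀lt : j₀ < 126 := by
      rw [← hj₀, ENat.coe_le_coe] at hle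
      omega
    rw [← hj₀, ENat.toENNReal_coe, Finset.sum_eq_single_of_mem j₀ (Finset.mem_range.2 hj₀lt)]
    · rw [Set.indicator_of_mem (show ω ∈ {ω : PointConfig (V3 × V3) | ω.count S = (j₀ : ℕ∞)} from hj₀.symm),
        Pi.one_apply, mul_one]
    · intro j _ hne
      rw [Set.indicator_of_notMem, mul_zero]
      intro hj
      exact hne (ENat.coe_inj.1 (hj₀.trans hj)).symm
  rw [Literature.MathematicalPhysics.KineticTheory.PointProcess.density,
    lintegral_congr_ae (hμ.mono fun ω hω => hpt ω hω),
    lintegral_finsetSum _ fun j _ => (measurable_one.indicator (hA j)).const_mul _]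
  refine Finset.sum_congr rfl fun j _ => ?_
  rw [lintegral_const_mul _ (measurable_one.indicator (hA j)), lintegral_indicator_one (hA j)]

/-- **A probability local limit of the x-averaged blown-up canonical laws has density exactly `σ³`**
(`0 < σ ≤ 1/2`, `a, θ > 0`): the level events `{N([0,1)³ × ℝ³) = j}` are local events of the window `Λ_0`, their
probabilities converge, and every finite-`N` density is `σ³`. -/
theorem density_of_isCanonicalLocalLimit {σ a θ : ℝ} {u₀ : V3} (hσ : 0 < σ) (hσ2 : σ ≤ 1 / 2) (ha : 0 < a)
    (hθ : 0 < θ) {N : ℕ → ℕ}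
    {Φ : ∀ k, HardSphereFlow (Literature.Analysis.FluidPDE.Torus.geometry (Fin 3)) (hsDiameter σ (N k)) (N k + 1)}
    {G : Measure (PointConfig (V3 × V3))} [IsProbabilityMeasure G] (hG : IsCanonicalLocalLimit σ a θ u₀ N Φ G) :
    density G = ENNReal.ofReal (σ ^ 3) := by
  set S : Set (V3 × V3) := Prod.fst ⁻¹' unitCube (Fin 3) with hS
  have hA : ∀ j : ℕ, MeasurableSet {ω : PointConfig (V3 × V3) | ω.count S = (j : ℕ∞)} := measurableSet_count_unitCube_eq
  have hΛm : MeasurableSet (centredBox (d := Fin 3) 0) := measurableSet_centredBox_fin3 0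
  -- level events are local events of the window `Λ_0`
  have hpre : ∀ j : ℕ, windowRestrict (M := V3) (centredBox (d := Fin 3) 0) ⁻¹'
      {ω : PointConfig (V3 × V3) | ω.count S = (j : ℕ∞)} = {ω : PointConfig (V3 × V3) | ω.count S = (j : ℕ∞)} := by
    intro j
    ext ω
    simp only [mem_preimage, mem_setOf_eq, hS, count_windowRestrict_centredBox_zero]
  -- convergence of the level probabilities
  have hconv : ∀ j : ℕ, Tendsto (fun k => canonicalBlowUpLaw σ a θ u₀ (N k) (Φ k)
      {ω : PointConfig (V3 × V3) | ω.count S = (j : ℕ∞)}) atTop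
      (𝓝 (G {ω : PointConfig (V3 × V3) | ω.count S = (j : ℕ∞)})) := by
    intro j
    have h := hG (centredBox 0) hΛm (isBounded_centredBox 0) _ (hA j)
    simp only [Literature.MathematicalPhysics.KineticTheory.PointProcess.windowLaw,
      Measure.map_apply (measurable_windowRestrict hΛm) (hA j), hpre] at h
    exact h
  -- densities as finite sums of level probabilities
  have hGsum := density_eq_sum_of_ae_isHardCore G (ae_isHardCore_of_isCanonicalLocalLimit hσ hσ2 ha hθ hG)
  have hksum : ∀ k, ∑ j ∈ Finset.range 126, (j : ℝ≥0∞) *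
      canonicalBlowUpLaw σ a θ u₀ (N k) (Φ k) {ω : PointConfig (V3 × V3) | ω.count S = (j : ℕ∞)} =
        ENNReal.ofReal (σ ^ 3) := by
    intro k
    have hae : ∀ᵐ ω ∂(canonicalBlowUpLaw σ a θ u₀ (N k) (Φ k)), IsHardCore 1 ω :=
      ae_isHardCore_canonicalBlowUp hσ a θ u₀ (N k) (Φ k)
    rw [← density_eq_sum_of_ae_isHardCore _ hae]
    exact density_canonicalBlowUp σ a θ u₀ hσ hσ2 ha hθ (N k) (Φ k)
  have hlim : Tendsto (fun k => ∑ j ∈ Finset.range 126, (j : ℝ≥0∞) *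
      canonicalBlowUpLaw σ a θ u₀ (N k) (Φ k) {ω : PointConfig (V3 × V3) | ω.count S = (j : ℕ∞)}) atTop
      (𝓝 (∑ j ∈ Finset.range 126, (j : ℝ≥0∞) * G {ω : PointConfig (V3 × V3) | ω.count S = (j : ℕ∞)})) :=
    tendsto_finsetSum _ fun j _ => ENNReal.Tendsto.const_mul (hconv j) (Or.inr (ENNReal.natCast_ne_top j))
  rw [hGsum]
  refine tendsto_nhds_unique hlim ?_
  simp_rw [hksum]
  exact tendsto_const_nhds

/-! ## (E1) from bare setwise sequential compactness -/

/-- **(E1) reduces to the existence of probability local limits.** If along a subsequence of any sequence of sizes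
`N k → ∞` the x-averaged blown-up canonical laws (`0 < σ ≤ 1/2`, `a, θ > 0`) converge setwise on every bounded
window to SOME probability law `G`, then `CanonicalBlowUpLocallyCompact` holds: translation invariance
(`isTranslationInvariant_of_isCanonicalLocalLimit`), the unit hard core (`ae_isHardCore_of_isCanonicalLocalLimit`)
and the density `σ³` (`density_of_isCanonicalLocalLimit`) of `G` are automatic. -/
theorem canonicalBlowUpLocallyCompact_of_exists_localLimit :
    (∀ (σ a θ : ℝ) (u₀ : V3), 0 < σ → σ ≤ 1 / 2 → 0 < a → 0 < θ →
      ∀ (N : ℕ → ℕ)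
        (Φ : ∀ k, HardSphereFlow (Literature.Analysis.FluidPDE.Torus.geometry (Fin 3)) (hsDiameter σ (N k)) (N k + 1)),
        Tendsto N atTop atTop →
        ∃ κ : ℕ → ℕ, StrictMono κ ∧ ∃ G : Measure (PointConfig (V3 × V3)), IsProbabilityMeasure G ∧
          IsCanonicalLocalLimit σ a θ u₀ (fun j => N (κ j)) (fun j => Φ (κ j)) G) →
    CanonicalBlowUpLocallyCompact := by
  intro h σ a θ u₀ hσ hσ2 ha hθ N Φ hN
  obtain ⟨κ, hκ, G, hGP, hG⟩ := h σ a θ u₀ hσ hσ2 ha hθ N Φ hN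
  exact ⟨κ, hκ, G, hGP, isTranslationInvariant_of_isCanonicalLocalLimit hσ hσ2 ha hθ (hN.comp hκ.tendsto_atTop) hG,
    ae_isHardCore_of_isCanonicalLocalLimit hσ hσ2 ha hθ hG, density_of_isCanonicalLocalLimit hσ hσ2 ha hθ hG, hG⟩

end Summit.AtomisticToContinuum.HydrodynamicLimit.Theorems.KiferCompactification

end
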